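import Summits.BirchSwinnertonDyer.BirchSwinnertonDyer.Theses.PrintX8VSC
import Summits.BirchSwinnertonDyer.BirchSwinnertonDyer.Theorems.PrintX8VSCIotaResidueContraOrbit
import Summits.BirchSwinnertonDyer.BirchSwinnertonDyer.Theorems.SignedLowerHalvesSprungLowerDivisibilityAtThreeIotaDoorContraClosedOfPTMatar
import HarnessLib

/-!
# Line `iota-door-contra` for crux `PrintX8VSC.KatoFineLowerSporadicGivenHeldX8Contra` (K′ = item stmt-BirchSwinnertonDyer-23732, route
# `PrintX8VSC`, OPEN rev 4; guard = thm714 → thm716_contra → period3 → `HeldFactsIotaDoorX8Contra` (PT ∧ Kato 12.4 ∧ Matar)) —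
# skeleton v4 (LEAD g10, 2026-08-28): the ONE research stub is RESHAPED TO ITS ι-ORBIT FORM `stub_iotaOrbitResidueContra`
# (w2 g12 p679032/p679566: in print keying `k + j = k′ + j′` on a sporadic `ι`-orbit, so the residue `j(ι𝔭) < k(𝔭)` is a property of
# the ORBIT, `m < k + k′`, and carries for free `j(𝔭) < k(ι𝔭)`, `1 ≤ k(𝔭)`, `1 ≤ k(ι𝔭)`); the door is displayed with its CURRENT
# two-fact trust base {PT functional model, Matar 1.1} + the guard's Thm 7.14 (LEAD g9 p678813 over w3 g10 p677954 — Kato 2004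
# Thm 12.4 is no longer an input of the door); the composition is ONE LINE BY NAME
# (`PrintX8VSCIotaDoorContra.katoFineLowerSporadicGivenHeldX8Contra_iff_orbitResidue`, w2 g12 p679566).

History: v1–v3 (LEAD g7, 2026-08-28T22:4x–22:56Z; sha16 fab3f9bc7792d8b2 registered on 23732) = x8 birth skeleton with the ι-DOOR closed
in-skeleton and ONE stub `stub_iotaResidueContra` (`j(ι𝔭) < k(𝔭) → k ≤ x′`). v4 = same line, same composition idea (door ∨ residue,
`le_or_gt` on `ℕ∞` — now inside w2's iff), ONE stub, STRICTLY MORE displayed hypotheses (same strength: the iff).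

Written by the LEAD of the parent crux 19875 `SprungLowerDivisibilityAtThree` (line `chromatic-common-zeros`), for the print-keyed twin
route PrintX8VSC. NOTHING HERE PROVES ANYTHING NEW: the crux K′, K1, leaf X8 and BSD are NOT proved; the door's inputs (PT functional
model, Matar 1.1 — two of the three conjuncts of the held pack `HeldFactsIotaDoorX8Contra`, item 23731 — and Sprung Thm 7.14 = the
guard's `h714`) are PUBLISHED theorems typed statement-only in `Literature/` (no `_holds`) and enter through the crux's own guard.

THE LINE at a sporadic height-one `𝔭` (`p ∉ 𝔭`, no `ω̃ₙ ∈ 𝔭`) that is a common zero of both Néron-normalised colours; notation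
`k = ℓ_𝔭(I.H ⧸ Cs.Z)` (zeta index), `j = min_• ℓ_𝔭(Λ ⧸ range C•.colMap)` (local index), `x′ = ℓ_𝔭 Y′.X` (fine), `ι𝔭 = comap (invol p) 𝔭`,
`k′ = k(ι𝔭)`, `j′ = j(ι𝔭)`, `m = k + j = k′ + j′` (common-zero multiplicity, `ι`-symmetric on X8):
* DOOR `k ≤ j′` (⟺ `k′ ≤ j` ⟺ `k + k′ ≤ m`): Kato's fine inequality `k ≤ x′` follows from the CONTRA F-α♮′ telescope AT THE MIRROR
  PRIME, `j′ ≤ x′` (`ChromaticCommonZeros.cokerBoundIotaOffT_contra_of_poitouTate_of_thm714'`, w3 g10 p677954: Poitou–Tate in the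
  functional model + Matar 2020 Thm 1.1 + Sprung Thm 7.14; 𝐇¹ ↪ Λ via Col♯ and UFD 𝔭-local cyclicity replace Kato Thm 12.4), through
  `ChromaticCommonZeros.katoFineLowerAt_of_iotaDoor_contra` (w3 g9 p670914) — theorem `iotaDoorContra` below =
  `ChromaticCommonZeros.iotaDoorContra_sporadic_of_poitouTate_of_matar_of_thm714` (LEAD g9 p678813), sorry-free;
* ORBIT RESIDUE `m < k + k′` (⟺ `j′ < k` ⟺ `j < k′`; then `1 ≤ k`, `1 ≤ k′`): stub `stub_iotaOrbitResidueContra` = the Eisenstein (⊆)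
  half of Kato 2004 Conj. 12.10 at the sporadic common-zero `ι`-orbits of X8 curves at `p = 3` whose two members BOTH divide the index of
  Kato's zeta element in `𝐇¹`, with total zeta index exceeding the common-zero multiplicity — OPEN in print at `(3, a₃ = ±3)`;
  conjecturally EMPTY (no sporadic common zeros: Kurihara–Pollack Problem 3.2 / Sprung 2015 Conj. 5.6).
Registered stubs: ONE — `stub_iotaOrbitResidueContra` (research). Composition `KatoFineLowerSporadicGivenHeldX8Contra_of` closes the crux
BY NAME.
[cite: Kato2004Asterisque, Conj. 12.10 (p. 224), Thm. 12.6 (p. 222), (17.13.1) (p. 279–280)] [cite: Sprung2012, Thm. 7.14 (3) (p. 1504),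
Main Conj. 7.21 (p. 1505)] [cite: Sprung2017, Thm. 4.13, Cor. 4.14] [cite: Matar2020, Thm. 1.1] [cite: Kobayashi2003, Prop. 7.1, Thm. 7.3]
[cite: KuriharaPollack2007, Problem 3.2] [cite: Sprung2015, Conj. 5.6]
-/

set_option linter.dupNamespace false
set_option autoImplicit false

noncomputable section

open scoped Classical NumberField MatrixGroups ModularForm

open NumberField IsDedekindDomain CongruenceSubgroup WeierstrassCurve Field
  Literature.NumberTheory.EllipticCurves Literature.NumberTheory.EllipticCurves.ModularForms
  Literature.NumberTheory.EllipticCurves.ZpExtension Literature.NumberTheory.EllipticCurves.Sprung2017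
  Literature.NumberTheory.EllipticCurves.Sprung2012 Literature.NumberTheory.EllipticCurves.Rank1Residual
  Literature.NumberTheory.EllipticCurves.IwasawaAlgebra Literature.NumberTheory.EllipticCurves.Kato2004
  Literature.NumberTheory.EllipticCurves.Module
  Summit.BirchSwinnertonDyer.BirchSwinnertonDyer.Theorems


namespace Summit.BirchSwinnertonDyer.BirchSwinnertonDyer.Cruxes.KatoFineLowerSporadicGivenHeldX8Contra.IotaDoorContra

/-! ## The ONE stub: the research residue in ι-ORBIT form (w2 g12 text; short names under this file's `open`s) -/

/-- **stub ι-ORBIT RESIDUE (print currency)** behind the three held facts + the ι-door pack `HeldFactsIotaDoorX8Contra` (Sprung Thm 7.14,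
Thm 7.16 print-keyed `_contra`, period unit at 3; PT functional model, Kato 12.4 (idle), Matar 1.1): at a sporadic height-one `𝔭 ∌ p`,
common zero of both normalised colours, lying on an `ι`-ORBIT OF THE RESIDUE — `j(ι𝔭) < k(𝔭)` (v3's `stub_iotaResidueContra`), and, FREE on
class X8 (`k + j = k′ + j′`, w2 g12 `ChromaticCommonZeros.iotaResidue_contra_iff_comap_invol`), `j(𝔭) < k(ι𝔭)`, `1 ≤ k(𝔭)`, `1 ≤ k(ι𝔭)` —
Kato's fine inequality `ℓ_𝔭(𝐇¹/Z) ≤ ℓ_𝔭 X₀` holds. = the Eisenstein (⊆) half of Kato 2004 Conj. 12.10 / Sprung 2012 Main Conj. 7.21 at the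
sporadic common-zero `ι`-orbits of X8 curves at `p = 3` whose two members BOTH divide the index of Kato's zeta element, with total zeta
index `k + k′` exceeding the common-zero multiplicity `m` — OPEN in print at (3, a₃ = ±3) (BSTW 2024: a_p = 0; Lei–Sujatha 2021 Thm 1.2
assumes Kato's IMC); conjecturally EMPTY (Kurihara–Pollack Problem 3.2 / Sprung 2015 Conj. 5.6: no sporadic common zeros). Research, XL.
TEXT = the right-hand side of `PrintX8VSCIotaDoorContra.katoFineLowerSporadicGivenHeldX8Contra_iff_orbitResidue` (w2 g12 p679566) verbatim.
What else is in scope for a worker (by name, not displayed): the telescope `j(ι𝔭) ≤ x′(𝔭)` (`cokerBoundIotaOffT_contra_of_poitouTate_of_thm714'`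
+ `katoFineLowerAt_of_iotaDoor_contra`), the identities `m^• = k + c^•` / `k + j = k′ + j′` (`…IotaDoorContraOrbit`), door ⟹ equality
`k = x′` given Kato's `x′ ≤ k` (`zeta_eq_fine_of_iotaDoor_contra_of_fine_le_zeta`, `…OrbitFine`), `h716c.invol_rational` (print upper bound).
Why it might fail: only through a failure of the signed main conjecture at a sporadic ι-orbit of an X8 curve.
[cite: Kato2004Asterisque, Conj. 12.10 (p. 224), Thm. 12.6 (p. 222)] [cite: Sprung2012, Thm. 7.16 (p. 1504), Main Conj. 7.21 (p. 1505)]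
[cite: Sprung2017, Thm. 4.13, Cor. 4.14] [cite: KuriharaPollack2007, Problem 3.2] [cite: Sprung2015, Conj. 5.6] [cite: LeiLim2022, Rem. 4.5] -/
theorem stub_iotaOrbitResidueContra :
    thm714_sharpFlatSelmerDual_finite_torsion → thm716_sharpFlatCharIdeal_divisibility_contra →
      realPeriodRat_eq_unit_mul_plusPeriod_three →
      Summit.BirchSwinnertonDyer.BirchSwinnertonDyer.Theses.PrintX8VSC.HeldFactsIotaDoorX8Contra →
      ∀ (W : WeierstrassCurve ℚ) [W.IsElliptic] [W.IsGloballyMinimal] (p : ℕ) [Fact p.Prime]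
      [ContinuousSMul ℤ_[p] (W.tateModule p)] [Module.Free ℤ_[p] (W.tateModule p)]
      [Module.Finite ℤ_[p] (W.tateModule p)],
      ClassX8 W p → ∀ (κ : ZpExtension ℚ p) (γ : Field.absoluteGaloisGroup ℚ),
      κ.IsCyclotomic → κ.IsTopGenerator γ → IsCyclotomicVariable p γ →
      ∀ (v : HeightOneSpectrum (𝓞 ℚ)), (p : 𝓞 ℚ) ∈ v.asIdeal →
      ∀ (g : Field.absoluteGaloisGroup (v.adicCompletion ℚ)),
      κ.IsTopGenerator (resGalOfEmb (closureEmb (K := ℚ) (v.adicCompletion ℚ)) g) →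
      ∀ (cneg : localPoints W (v.adicCompletion ℚ)) (c : ℕ → localPoints W (v.adicCompletion ℚ)),
      IsHondaSystem κ (closureEmb (K := ℚ) (v.adicCompletion ℚ)) W (W.frobeniusTrace p) g cneg c →
      ∀ (N : ℕ) (_ : NeZero N) (f : CuspForm (Gamma0 N) 2) (ϖ : ℚ) (Lsharp Lflat : IwasawaAlgebra p),
      IsNewformOf W f → (ϖ : ℝ) * W.realPeriodRat = plusPeriod f →
      IsSprungPair f p (W.frobeniusTrace p) Lsharp Lflat →
      ∀ (I : Kato2004.IwasawaH1Data W p κ γ)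
      (Cs : SharpFlatColemanKatoDataContra W p f ϖ κ γ (closureEmb (K := ℚ) (v.adicCompletion ℚ))
      (W.frobeniusTrace p) g c Chroma.sharp I)
      (Cf : SharpFlatColemanKatoDataContra W p f ϖ κ γ (closureEmb (K := ℚ) (v.adicCompletion ℚ))
      (W.frobeniusTrace p) g c Chroma.flat I),
      Cs.Z = Cf.Z →
      ∀ (Y : W.FineSelmerDualData κ γ⁻¹) (𝔭 : PrimeSpectrum (IwasawaAlgebra p)), 𝔭.asIdeal.height = 1 →
      (p : IwasawaAlgebra p) ∉ 𝔭.asIdeal →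
      (¬ ∃ n : ℕ, ((cyclotomicOmega p n).map (Int.castRingHom ℤ_[p]) : PowerSeries ℤ_[p]) ∈ 𝔭.asIdeal) →
      (∀ (col' : Chroma) (G' : IwasawaAlgebra p),
      iwasawaToPowerSeries p G' =
      PowerSeries.C (ϖ : ℚ_[p]) * iwasawaToPowerSeries p (chromaticL col' Lsharp Lflat) →
      G' ∈ 𝔭.asIdeal) →
      -- the v3 residue: deficient local index at the mirror prime, `j(ι𝔭) < k(𝔭)`
      min (Module.lengthAt (IwasawaAlgebra p) (IwasawaAlgebra p ⧸ LinearMap.range Cs.colMap)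
      (PrimeSpectrum.comap (invol p).toRingHom 𝔭))
      (Module.lengthAt (IwasawaAlgebra p) (IwasawaAlgebra p ⧸ LinearMap.range Cf.colMap)
      (PrimeSpectrum.comap (invol p).toRingHom 𝔭)) <
      Module.lengthAt (IwasawaAlgebra p) (I.H ⧸ Cs.Z) 𝔭 →
      -- FREE: the residue at the mirror, `j(𝔭) < k(ι𝔭)`
      min (Module.lengthAt (IwasawaAlgebra p) (IwasawaAlgebra p ⧸ LinearMap.range Cs.colMap) 𝔭)
      (Module.lengthAt (IwasawaAlgebra p) (IwasawaAlgebra p ⧸ LinearMap.range Cf.colMap) 𝔭) <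
      Module.lengthAt (IwasawaAlgebra p) (I.H ⧸ Cs.Z) (PrimeSpectrum.comap (invol p).toRingHom 𝔭) →
      -- FREE: both members of the orbit carry zeta index
      1 ≤ Module.lengthAt (IwasawaAlgebra p) (I.H ⧸ Cs.Z) 𝔭 →
      1 ≤ Module.lengthAt (IwasawaAlgebra p) (I.H ⧸ Cs.Z) (PrimeSpectrum.comap (invol p).toRingHom 𝔭) →
      Module.lengthAt (IwasawaAlgebra p) (I.H ⧸ Cs.Z) 𝔭 ≤ Module.lengthAt (IwasawaAlgebra p) Y.X 𝔭 := by
  sorry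

/-! ## The door, PROVED from {PT functional model, Matar 1.1} + the guard's Thm 7.14 (displayed; Kato 12.4 no longer an input) -/

/-- **THE ι-DOOR IN PRINT CURRENCY, PROVED** from TWO of the held pack's inputs (Sprung (3)/(7.18)∞ Poitou–Tate functional model,
Matar 2020 Thm 1.1) and the guard's Sprung Thm 7.14 (`h714`, supplying the fine dual's torsion on X8 and `𝐇¹ ≠ 0`): at a sporadic
height-one `𝔭` (`p ∉ 𝔭`, no `ω̃ₙ ∈ 𝔭`), common zero of both normalised colours, INSIDE the door `ℓ_𝔭(I.H ⧸ Cs.Z) ≤ min_• ℓ_{ι𝔭}(Λ ⧸ range C•.colMap)`,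
Kato's fine inequality `ℓ_𝔭(I.H ⧸ Cs.Z) ≤ ℓ_𝔭 Y′.X` holds for the natural-keyed `Y′ : FineSelmerDualData κ γ⁻¹`. Proof = LEAD g9 p678813
`ChromaticCommonZeros.iotaDoorContra_sporadic_of_poitouTate_of_matar_of_thm714` (the telescope `cokerBoundIotaOffT_contra_of_poitouTate_of_thm714'`
of w3 g10 p677954 at the mirror prime, then `katoFineLowerAt_of_iotaDoor_contra` of w3 g9 p670914). Displayed for the record; the
composition below obtains the door inside w2 g12's iff from the pack `hF`.
[cite: Kato2004Asterisque, (17.13.1) (p. 279–280)] [cite: Sprung2012, Thm. 7.14 (3) (p. 1504)] [cite: Matar2020, Thm. 1.1]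
[cite: Kobayashi2003, Prop. 7.1, Thm. 7.3 (pp. 12–13)] [cite: Wingberg1989, Cor. 2.5] -/
theorem iotaDoorContra (hPT : thm714seq_sharpFlat_poitouTate_functionalModel)
    (hMatar : matar2020_thm11_selmerDualTorsion_pseudoIso_fineSelmerDual) (h714 : thm714_sharpFlatSelmerDual_finite_torsion) :
    ∀ (W : WeierstrassCurve ℚ) [W.IsElliptic] [W.IsGloballyMinimal] (p : ℕ) [Fact p.Prime]
      [ContinuousSMul ℤ_[p] (W.tateModule p)] [Module.Free ℤ_[p] (W.tateModule p)]
      [Module.Finite ℤ_[p] (W.tateModule p)],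
      ClassX8 W p → ∀ (κ : ZpExtension ℚ p) (γ : Field.absoluteGaloisGroup ℚ),
      κ.IsCyclotomic → κ.IsTopGenerator γ → IsCyclotomicVariable p γ →
    ∀ (v : HeightOneSpectrum (𝓞 ℚ)), (p : 𝓞 ℚ) ∈ v.asIdeal →
    ∀ (g : Field.absoluteGaloisGroup (v.adicCompletion ℚ)),
      κ.IsTopGenerator (resGalOfEmb (closureEmb (K := ℚ) (v.adicCompletion ℚ)) g) →
    ∀ (cneg : localPoints W (v.adicCompletion ℚ)) (c : ℕ → localPoints W (v.adicCompletion ℚ)),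
      IsHondaSystem κ (closureEmb (K := ℚ) (v.adicCompletion ℚ)) W (W.frobeniusTrace p) g cneg c →
    ∀ (N : ℕ) (_ : NeZero N) (f : CuspForm (Gamma0 N) 2) (ϖ : ℚ) (Lsharp Lflat : IwasawaAlgebra p),
      IsNewformOf W f → (ϖ : ℝ) * W.realPeriodRat = plusPeriod f →
      IsSprungPair f p (W.frobeniusTrace p) Lsharp Lflat →
    ∀ (I : Kato2004.IwasawaH1Data W p κ γ)
      (Cs : SharpFlatColemanKatoDataContra W p f ϖ κ γ (closureEmb (K := ℚ) (v.adicCompletion ℚ))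
        (W.frobeniusTrace p) g c Chroma.sharp I)
      (Cf : SharpFlatColemanKatoDataContra W p f ϖ κ γ (closureEmb (K := ℚ) (v.adicCompletion ℚ))
        (W.frobeniusTrace p) g c Chroma.flat I),
      Cs.Z = Cf.Z →
    ∀ (Y : W.FineSelmerDualData κ γ⁻¹) (𝔭 : PrimeSpectrum (IwasawaAlgebra p)), 𝔭.asIdeal.height = 1 →
      (p : IwasawaAlgebra p) ∉ 𝔭.asIdeal →
      (¬ ∃ n : ℕ, ((cyclotomicOmega p n).map (Int.castRingHom ℤ_[p]) : PowerSeries ℤ_[p]) ∈ 𝔭.asIdeal) →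
      (∀ (col' : Chroma) (G' : IwasawaAlgebra p),
        iwasawaToPowerSeries p G' =
          PowerSeries.C (ϖ : ℚ_[p]) * iwasawaToPowerSeries p (chromaticL col' Lsharp Lflat) →
        G' ∈ 𝔭.asIdeal) →
      Module.lengthAt (IwasawaAlgebra p) (I.H ⧸ Cs.Z) 𝔭 ≤
          min (Module.lengthAt (IwasawaAlgebra p) (IwasawaAlgebra p ⧸ LinearMap.range Cs.colMap)
                (PrimeSpectrum.comap (invol p).toRingHom 𝔭))
            (Module.lengthAt (IwasawaAlgebra p) (IwasawaAlgebra p ⧸ LinearMap.range Cf.colMap)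
                (PrimeSpectrum.comap (invol p).toRingHom 𝔭)) →
      Module.lengthAt (IwasawaAlgebra p) (I.H ⧸ Cs.Z) 𝔭 ≤ Module.lengthAt (IwasawaAlgebra p) Y.X 𝔭 :=
  ChromaticCommonZeros.iotaDoorContra_sporadic_of_poitouTate_of_matar_of_thm714 hPT hMatar h714

/-! ## The composition (sorry-free, one line by name): crux K′ BY NAME ⟸ orbit residue (stub) via w2 g12's iff -/

/-- **THE SKELETON**: the crux decl `PrintX8VSC.KatoFineLowerSporadicGivenHeldX8Contra` (item 23732) BY NAME from the ONE registered stub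
`stub_iotaOrbitResidueContra`, through `PrintX8VSCIotaDoorContra.katoFineLowerSporadicGivenHeldX8Contra_iff_orbitResidue` (w2 g12
p679566: modulo the guard, K′ ⟺ its orbit residue — inside the ι-door the guard's pack proves Kato's fine inequality; outside, the
residue's three extra hypotheses are free on X8). -/
theorem KatoFineLowerSporadicGivenHeldX8Contra_of :
    Summit.BirchSwinnertonDyer.BirchSwinnertonDyer.Theses.PrintX8VSC.KatoFineLowerSporadicGivenHeldX8Contra :=
  PrintX8VSCIotaDoorContra.katoFineLowerSporadicGivenHeldX8Contra_iff_orbitResidue.mpr stub_iotaOrbitResidueContra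

end Summit.BirchSwinnertonDyer.BirchSwinnertonDyer.Cruxes.KatoFineLowerSporadicGivenHeldX8Contra.IotaDoorContra

end
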